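import Mathlib
import HarnessLib
import Summits.Ventures.LatticeQCDFlow.Exactness.IMHKernel
import Summits.Ventures.LatticeQCDFlow.Exactness.FlowSamplerFluxSymmetricAcceptance

/-!
# LatticeQCDFlow / Exactness — THE FLUX CONE: flux-symmetric landing densities on flow proposals are closed under sums and mixtures, and
# every "residual-min" density `min(r(x, η), r(z, η)·w(z)/w(x))` is one — so every stage of every delayed-rejection ∕ multi-stage scheme
# on flow draws, however the stages are nested, is exact by one and the same argument

HONEST FRAMING: exact (Metropolis-corrected) sampling algorithms for lattice gauge theory;
figures of merit are autocorrelation/cost numbers at stated couplings and volumes; no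
continuum-physics claim.

Venture `LatticeQCDFlow` (cell pub-lqcd), topic `Exactness`, FANOUT row 30 (lean-1 GEN-43, part III: the principle behind parts I–II).
NEW WORK of the cell over `IMHKernel` and `FlowSamplerFluxSymmetricAcceptance` (`fluxSymmetric_isReversible`: a kernel
`K(x, B) = ∫_B ã(x, z) q(dz) + (1 − ∫ ã(x, ·) dq)·1_B(x)` with `w(x)ã(x, z) = w(z)ã(z, x)` is `π`-reversible); no definition is introduced,
nothing is cited as a fact.  Printed counterpart NAMED ONLY: the "detailed balance for each stage separately" structure of delayed rejection
(Tierney–Mira 1999; Mira 2001).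

## Results [all ours] (general measurable `Ω`; flow law `q`; weight `w > 0`; a flux-symmetric density is an `ã : Ω → Ω → ℝ≥0∞` with
## `w(x)ã(x, z) = w(z)ã(z, x)`)

* `fluxSymm_add`: sums of flux-symmetric densities are flux-symmetric (first stage + second stage + …).
* `fluxSymm_lintegral`: `ν`-MIXTURES `∫ ã_η dν(η)` of flux-symmetric families are flux-symmetric (integrating out the rejected history `η`).
* **`residualMin_fluxSymm`**: for ANY residual function `r ≥ 0` (the probability of having rejected the history `η` from a given state),
  the RESIDUAL-MIN density `d_η(x, z) = min(r(x, η), r(z, η)·w(z)/w(x))` is flux-symmetric: `w(x)d_η(x, z) = min(w(x)r(x, η), w(z)r(z, η))`.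
  Instances: `r ≡ 1` is the Metropolis density `min(1, w(z)/w(x))` (`residualMin_one_eq_imhAcceptE`); `r(u, y₁) = 1 − a(u, y₁)` is the
  Tierney–Mira second stage of `IMHDelayedRejectionExact` (`residualMin_dr_eq`); deeper stages take `r` = the probability of the whole
  rejected prefix.
* **`fluxCone_isReversible` ∕ `fluxCone_invariant`**: hence ANY accept/reject kernel on flow proposals whose landing density is a sum of a
  flux-symmetric density and a `ν`-mixture of residual-min densities is `π`-reversible, and `π`-invariant when Markov — the one-line reason
  behind `IMHDelayedRejectionExact`, `…GeneralSecondStage` (with `ℓ` symmetric), and every further correctly priced stage.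
-/

namespace Summit.Ventures.LatticeQCDFlow.Exactness

open MeasureTheory ProbabilityTheory
open scoped ENNReal

variable {Ω : Type*} [MeasurableSpace Ω] {q : Measure Ω} [IsProbabilityMeasure q] {w : Ω → ℝ}

/-! ## §1 The cone operations -/

omit [MeasurableSpace Ω] in
/-- **Sums of flux-symmetric densities are flux-symmetric.** [ours] -/
theorem fluxSymm_add {a b : Ω → Ω → ℝ≥0∞} (ha : ∀ x z, ENNReal.ofReal (w x) * a x z = ENNReal.ofReal (w z) * a z x)
    (hb : ∀ x z, ENNReal.ofReal (w x) * b x z = ENNReal.ofReal (w z) * b z x) (x z : Ω) :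
    ENNReal.ofReal (w x) * (a x z + b x z) = ENNReal.ofReal (w z) * (a z x + b z x) := by
  rw [mul_add, mul_add, ha, hb]

omit [MeasurableSpace Ω] in
/-- **Mixtures of flux-symmetric families are flux-symmetric**: `w(x)·∫ ã_η(x, z) dν = w(z)·∫ ã_η(z, x) dν`. [ours] -/
theorem fluxSymm_lintegral {H : Type*} [MeasurableSpace H] (ν : Measure H) {a : H → Ω → Ω → ℝ≥0∞}
    (hmeas : ∀ x z, Measurable fun η => a η x z) (ha : ∀ η x z, ENNReal.ofReal (w x) * a η x z = ENNReal.ofReal (w z) * a η z x)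
    (x z : Ω) :
    ENNReal.ofReal (w x) * ∫⁻ η, a η x z ∂ν = ENNReal.ofReal (w z) * ∫⁻ η, a η z x ∂ν := by
  rw [← lintegral_const_mul _ (hmeas x z), ← lintegral_const_mul _ (hmeas z x)]
  exact lintegral_congr fun η => ha η x z

/-! ## §2 The atoms: residual-min densities -/

omit [MeasurableSpace Ω] in
/-- **THE RESIDUAL-MIN DENSITY IS FLUX-SYMMETRIC**: `w(x)·min(r(x), r(z)·w(z)/w(x)) = min(w(x)r(x), w(z)r(z))` for every residual pair
`r(x), r(z) ∈ [0, ∞]`. [ours] -/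
theorem residualMin_fluxSymm (hw0 : ∀ x, 0 < w x) (rx rz : ℝ≥0∞) (x z : Ω) :
    ENNReal.ofReal (w x) * min rx (ENNReal.ofReal (w z / w x) * rz) = min (ENNReal.ofReal (w x) * rx) (ENNReal.ofReal (w z) * rz) := by
  have key : ENNReal.ofReal (w x) * (ENNReal.ofReal (w z / w x) * rz) = ENNReal.ofReal (w z) * rz := by
    rw [← mul_assoc, ← ENNReal.ofReal_mul (hw0 x).le, mul_div_cancel₀ _ (hw0 x).ne']
  rcases le_total rx (ENNReal.ofReal (w z / w x) * rz) with h | h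
  · rw [min_eq_left h, min_eq_left ((mul_le_mul_of_nonneg_left h bot_le).trans_eq key)]
  · rw [min_eq_right h, key, min_eq_right (key.symm.trans_le (mul_le_mul_of_nonneg_left h bot_le))]

omit [MeasurableSpace Ω] in
/-- … hence symmetric under `x ↔ z`: `w(x)·d(x, z) = w(z)·d(z, x)` with `d(x, z) = min(r(x), r(z)w(z)/w(x))`. [ours] -/
theorem residualMin_flux_swap (hw0 : ∀ x, 0 < w x) (r : Ω → ℝ≥0∞) (x z : Ω) :
    ENNReal.ofReal (w x) * min (r x) (ENNReal.ofReal (w z / w x) * r z) =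
      ENNReal.ofReal (w z) * min (r z) (ENNReal.ofReal (w x / w z) * r x) := by
  rw [residualMin_fluxSymm hw0, residualMin_fluxSymm hw0, min_comm]

omit [MeasurableSpace Ω] in
/-- **Instance `r ≡ 1`: the Metropolis density.**  `min(1, w(z)/w(x)·1) = imhAcceptE w x z`. [ours] -/
theorem residualMin_one_eq_imhAcceptE (x z : Ω) :
    min 1 (ENNReal.ofReal (w z / w x) * 1) = imhAcceptE w x z := by
  rw [mul_one, imhAcceptE, imhAccept, ENNReal.ofReal_min, ENNReal.ofReal_one]

omit [MeasurableSpace Ω] in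
/-- **Instance `r(u) = 1 − a(u, y₁)`: the Tierney–Mira second stage of `IMHDelayedRejectionExact`.**
`min(1 − a(x, y₁), (w z/w x)(1 − a(z, y₁))) = d(x, y₁, z)` (as real numbers). [ours] -/
theorem residualMin_dr_eq (x y₁ z : Ω) :
    min (1 - imhAccept w x y₁) (w z / w x * (1 - imhAccept w z y₁)) =
      min (1 - imhAccept w x y₁) (w z * (1 - imhAccept w z y₁) / w x) := by
  rw [div_mul_eq_mul_div]

/-! ## §3 Every kernel in the cone is exact -/

/-- Measurability of a residual-min density mixed over the history, jointly in `(x, z)`. [ours, bookkeeping] -/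
theorem measurable_residualMin_lintegral {H : Type*} [MeasurableSpace H] (ν : Measure H) [SFinite ν] (hw : Measurable w)
    {r : Ω → H → ℝ≥0∞} (hr : Measurable (Function.uncurry r)) :
    Measurable (Function.uncurry fun x z : Ω => ∫⁻ η, min (r x η) (ENNReal.ofReal (w z / w x) * r z η) ∂ν) := by
  have h : Measurable fun t : (Ω × Ω) × H => min (r t.1.1 t.2) (ENNReal.ofReal (w t.1.2 / w t.1.1) * r t.1.2 t.2) :=
    (hr.comp ((measurable_fst.comp measurable_fst).prodMk measurable_snd)).min
      ((((hw.comp (measurable_snd.comp measurable_fst)).div (hw.comp (measurable_fst.comp measurable_fst))).ennreal_ofReal).mul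
        (hr.comp ((measurable_snd.comp measurable_fst).prodMk measurable_snd)))
  exact h.lintegral_prod_right'

/-- **THE FLUX CONE IS EXACT — DETAILED BALANCE.**  Let `b` be any jointly measurable flux-symmetric density (e.g. a first stage) and `r` any
jointly measurable residual; then ANY kernel with landing density `ã(x, z) = b(x, z) + ∫ min(r(x, η), r(z, η)w(z)/w(x)) ν(dη)` and the
accept/reject form `K(x, B) = ∫_B ã(x, z) q(dz) + (1 − ∫ ã(x, ·) dq)·1_B(x)` is reversible for `π = w·q`. [ours] -/
theorem fluxCone_isReversible {H : Type*} [MeasurableSpace H] (ν : Measure H) [SFinite ν] (hw : Measurable w) (hw0 : ∀ x, 0 < w x)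
    {b : Ω → Ω → ℝ≥0∞} (hb : Measurable (Function.uncurry b))
    (hbsym : ∀ x z, ENNReal.ofReal (w x) * b x z = ENNReal.ofReal (w z) * b z x)
    {r : Ω → H → ℝ≥0∞} (hr : Measurable (Function.uncurry r)) (K : Kernel Ω Ω)
    (hK : ∀ (x : Ω) {B : Set Ω}, MeasurableSet B → K x B =
      ∫⁻ z in B, (b x z + ∫⁻ η, min (r x η) (ENNReal.ofReal (w z / w x) * r z η) ∂ν) ∂q +
        (1 - ∫⁻ z, (b x z + ∫⁻ η, min (r x η) (ENNReal.ofReal (w z / w x) * r z η) ∂ν) ∂q) * B.indicator 1 x) :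
    Kernel.IsReversible K (q.withDensity fun x => ENNReal.ofReal (w x)) := by
  have hmeas : Measurable (Function.uncurry fun x z : Ω => b x z + ∫⁻ η, min (r x η) (ENNReal.ofReal (w z / w x) * r z η) ∂ν) :=
    hb.add (measurable_residualMin_lintegral ν hw hr)
  refine fluxSymmetric_isReversible hw hmeas (fun x z => ?_) K hK
  refine fluxSymm_add (a := b) (b := fun x z => ∫⁻ η, min (r x η) (ENNReal.ofReal (w z / w x) * r z η) ∂ν) hbsym (fun x z => ?_) x z
  exact fluxSymm_lintegral ν (a := fun η x z => min (r x η) (ENNReal.ofReal (w z / w x) * r z η))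
    (fun x z => (hr.comp (measurable_const.prodMk measurable_id)).min
      (((hr.comp (measurable_const.prodMk measurable_id))).const_mul _))
    (fun η x z => residualMin_flux_swap hw0 (fun u => r u η) x z) x z

/-- **… INVARIANCE** when the kernel is Markov. [ours] -/
theorem fluxCone_invariant {H : Type*} [MeasurableSpace H] (ν : Measure H) [SFinite ν] (hw : Measurable w) (hw0 : ∀ x, 0 < w x)
    {b : Ω → Ω → ℝ≥0∞} (hb : Measurable (Function.uncurry b))
    (hbsym : ∀ x z, ENNReal.ofReal (w x) * b x z = ENNReal.ofReal (w z) * b z x)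
    {r : Ω → H → ℝ≥0∞} (hr : Measurable (Function.uncurry r)) (K : Kernel Ω Ω) [IsMarkovKernel K]
    (hK : ∀ (x : Ω) {B : Set Ω}, MeasurableSet B → K x B =
      ∫⁻ z in B, (b x z + ∫⁻ η, min (r x η) (ENNReal.ofReal (w z / w x) * r z η) ∂ν) ∂q +
        (1 - ∫⁻ z, (b x z + ∫⁻ η, min (r x η) (ENNReal.ofReal (w z / w x) * r z η) ∂ν) ∂q) * B.indicator 1 x) :
    Kernel.Invariant K (q.withDensity fun x => ENNReal.ofReal (w x)) :=
  (fluxCone_isReversible ν hw hw0 hb hbsym hr K hK).invariant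

/-- **The pure residual-min stage** (`b = 0`): e.g. a stand-alone "upgrade" move priced against a history `η ∼ ν`. [ours] -/
theorem residualStage_isReversible {H : Type*} [MeasurableSpace H] (ν : Measure H) [SFinite ν] (hw : Measurable w)
    (hw0 : ∀ x, 0 < w x) {r : Ω → H → ℝ≥0∞} (hr : Measurable (Function.uncurry r)) (K : Kernel Ω Ω)
    (hK : ∀ (x : Ω) {B : Set Ω}, MeasurableSet B → K x B =
      ∫⁻ z in B, (∫⁻ η, min (r x η) (ENNReal.ofReal (w z / w x) * r z η) ∂ν) ∂q +
        (1 - ∫⁻ z, (∫⁻ η, min (r x η) (ENNReal.ofReal (w z / w x) * r z η) ∂ν) ∂q) * B.indicator 1 x) :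
    Kernel.IsReversible K (q.withDensity fun x => ENNReal.ofReal (w x)) := by
  refine fluxCone_isReversible ν hw hw0 (b := fun _ _ => 0) measurable_const (fun x z => by simp) hr K (fun x B hB => ?_)
  simp only [zero_add]
  exact hK x hB

end Summit.Ventures.LatticeQCDFlow.Exactness
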